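import Mathlib
import Summits.Ventures.PercRepro2.TypedA3PathRootEdge
import Summits.Ventures.PercRepro2.TypedThreeCopyRule

/-!
# The root edge at `o` beside the type-2 four-cycle `a₁ – b – o – a₃ – a₂`, I: states, forced
connections and the four terms (blind cell PercRepro2, night-3 g19, 2026-08-28;
`proofs/NIGHT3-CERT.md` §28)

Preparation for `TypedFourCycleRootEdge.lean` (the theorem `typedCount_root_edge_of_four_cycle`):
g18's three-copy rule `KBsym_eq_zero_of_Lo3_H3_Ho3` on configurations
(`KBsym_st_eq_zero_of_Lo3_H3_Ho3`), the connections forced by the carried cycle edges, the four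
terms `T₀, T₁, T₂, T₃` of the pointwise identity (the term without the new root edge `e` and its
three placements) and their first properties: a placement in a copy with `o ∈ C(a₁)` is the term
without `e` (`T₁_eq_of_conn`), a placement in a copy with `o ∈ C(a₂)` vanishes
(`T₁_eq_zero_of_conn`), and everything vanishes once a copy joins the roots (`all_zero_of_x`).
The statement proved in the sequel:

With `f₁ = {a₁, b}`, `f₂ = {o, b}`, `f₃ = {o, a₃}`, `f₄ = {a₂, a₃}` typed edges of type `2`, adding
a NEW edge `e = {a₁, o}` of type `1` does not change the typed base of `K₃`:

  `typedCount (insert e F) z (τ[e := 1]) K₃ = typedCount F z τ K₃`   (`typedCount_root_edge_of_four_cycle`)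

— the twenty «unexplained» equality cases of (ROOT-MONO-o) at `a ≤ 5` on distinct marks
(§27.16), proved. MECHANISM (symmetrised-pointwise on the kernel `KBsym` on states): each of the
four edges is closed in exactly one copy. A copy carrying `f₁, f₂` has `o ∈ C(a₁)` — opening `e`
there changes nothing; a copy carrying `f₃, f₄` has `o ∈ C(a₂)` — opening `e` there joins the
roots and kills the term; a copy carrying exactly one of `f₁, f₂` and one of `f₃, f₄` is MIXED:
once `e` is opened it carries `o, a₃ ∈ C(a₁)` or `o, b ∈ C(a₁), a₃ ∈ C(a₂)`, the copy carrying
`f₃, f₄` has `o, a₃ ∈ C(a₂)`, and the copy carrying `f₁, f₂` and the remaining edge supplies the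
third state of g18's three-copy rule `KBsym_eq_zero_of_Lo3_H3_Ho3` — so the mixed placement
vanishes. Counting the copies with `o ∈ C(a₁)`: one (the sum of the three placements is the
term without `e`), or two (then the third copy carries `f₃, f₄` and the three states are again
the rule's — the term without `e` vanishes, and so do all placements), or some copy carries all
four edges (`a₁ ↔ a₂` there: everything vanishes). Own work; standard axioms.
-/

namespace Summit.Ventures.PercRepro2

open UnionCluster

namespace CovForm

namespace Triangle

open OneTyped Untouched CoincRoot TypedRed

section States

section Conn

open Classical

variable {V : Type*} {E : Type*} [Fintype E] [DecidableEq E]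
variable (ends : E → Sym2 V) (o a₁ a₂ a₃ b : V)

omit [Fintype E] [DecidableEq E] in
/-- A configuration joining the roots has a state failing `Q`. -/
lemma st_q'_of_conn (u : Config E) (h : Conn ends u a₂ a₁) : (st ends o a₁ a₂ a₃ b u).q' = true := by
  unfold st St.q'
  exact decide_eq_true h

omit [Fintype E] [DecidableEq E] in
/-- A configuration with `a₃ ∈ C(a₂)` either fails `Q` or has `L₃ = false`, `H₃ = true`. -/
lemma st_of_conn_a2_a3 (u : Config E) (h3 : Conn ends u a₂ a₃) :
    (st ends o a₁ a₂ a₃ b u).q' = true ∨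
      st ends o a₁ a₂ a₃ b u =
        mkSt false (decide (Conn ends u a₁ o)) (decide (Conn ends u a₁ b)) false
          (decide (Conn ends u a₂ o)) (decide (Conn ends u a₂ b)) true := by
  by_cases hq : Conn ends u a₂ a₁
  · left
    unfold st St.q'
    exact decide_eq_true hq
  · right
    have h3' : ¬ Conn ends u a₁ a₃ := fun h' => hq (conn_trans h3 (conn_symm h'))
    unfold st mkSt
    simp only [h3, h3', decide_true, decide_false, hq]

omit [Fintype E] [DecidableEq E] in
/-- A configuration with `o, a₃ ∈ C(a₂)` either fails `Q` or has the state
`mkSt false false L_b false true H_b true`. -/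
lemma st_of_conn_a2_o_a3 (u : Config E) (ho : Conn ends u a₂ o) (h3 : Conn ends u a₂ a₃) :
    (st ends o a₁ a₂ a₃ b u).q' = true ∨
      st ends o a₁ a₂ a₃ b u =
        mkSt false false (decide (Conn ends u a₁ b)) false true (decide (Conn ends u a₂ b)) true := by
  by_cases hq : Conn ends u a₂ a₁
  · left
    unfold st St.q'
    exact decide_eq_true hq
  · right
    have ho' : ¬ Conn ends u a₁ o := fun h' => hq (conn_trans ho (conn_symm h'))
    have h3' : ¬ Conn ends u a₁ a₃ := fun h' => hq (conn_trans h3 (conn_symm h'))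
    unfold st mkSt
    simp only [ho, h3, ho', h3', decide_true, decide_false, hq]

omit [Fintype E] [DecidableEq E] in
/-- **g18's three-copy rule on configurations**: `p` with `o, a₃ ∈ C(a₁)`, `q` with `a₃ ∈ C(a₂)`,
`r` with `o, a₃ ∈ C(a₂)`: `KBsym = 0`. -/
lemma KBsym_st_eq_zero_of_Lo3_H3_Ho3 (p q r : Config E) (hpo : Conn ends p a₁ o)
    (hp3 : Conn ends p a₁ a₃) (hq3 : Conn ends q a₂ a₃) (hro : Conn ends r a₂ o)
    (hr3 : Conn ends r a₂ a₃) :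
    KBsym (st ends o a₁ a₂ a₃ b p) (st ends o a₁ a₂ a₃ b q) (st ends o a₁ a₂ a₃ b r) = 0 := by
  rcases st_of_conn_o_a3 ends o a₁ a₂ a₃ b p hpo hp3 with hqp | hsp
  · exact CoincRoot.KBsym_eq_zero_of_q' _ _ _ (Or.inl hqp)
  rcases st_of_conn_a2_a3 ends o a₁ a₂ a₃ b q hq3 with hqq | hsq
  · exact CoincRoot.KBsym_eq_zero_of_q' _ _ _ (Or.inr (Or.inl hqq))
  rcases st_of_conn_a2_o_a3 ends o a₁ a₂ a₃ b r hro hr3 with hqr | hsr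
  · exact CoincRoot.KBsym_eq_zero_of_q' _ _ _ (Or.inr (Or.inr hqr))
  rw [hsp, hsq, hsr]
  exact KBsym_eq_zero_of_Lo3_H3_Ho3 _ _ _ _ _ _ _ _ _ _ _

end Conn

end States

section Main

open Classical

variable {V : Type*} {E : Type*} [Fintype E] [DecidableEq E] {R : Type*} [Field R]
  [LinearOrder R] [IsStrictOrderedRing R]
variable (ends : E → Sym2 V) (o a₁ a₂ a₃ b : V)

/-! ## Bool bookkeeping: an edge open in exactly two of three copies -/

omit [Fintype E] [DecidableEq E] [LinearOrder R] [IsStrictOrderedRing R] in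
/-- A bit open in exactly two of three copies: the three positions of the closed copy. -/
lemma two_of_three_cases {p q r : Bool} (h : p.toNat + q.toNat + r.toNat = 2) :
    (p = false ∧ q = true ∧ r = true) ∨ (p = true ∧ q = false ∧ r = true) ∨
      (p = true ∧ q = true ∧ r = false) := by
  cases p <;> cases q <;> cases r <;> simp_all

omit [Fintype E] [DecidableEq E] [LinearOrder R] [IsStrictOrderedRing R] in
/-- Two copies carry the edge: the third does not. -/
lemma third_false {p q r : Bool} (h : p.toNat + q.toNat + r.toNat = 2) (hp : p = true)
    (hq : q = true) : r = false := by
  cases p <;> cases q <;> cases r <;> simp_all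

omit [Fintype E] [DecidableEq E] [LinearOrder R] [IsStrictOrderedRing R] in
/-- One copy carries the edge and one does not: the third carries it. -/
lemma third_true {p q r : Bool} (h : p.toNat + q.toNat + r.toNat = 2) (hp : p = true)
    (hq : q = false) : r = true := by
  cases p <;> cases q <;> cases r <;> simp_all

omit [Fintype E] [DecidableEq E] [LinearOrder R] [IsStrictOrderedRing R] in
/-- Two edges each open in exactly two copies: some copy carries both, and another copy carries
the first edge. -/
lemma some_copy_both_first {x y w : Config E} {f g : E}
    (hf : (x f).toNat + (y f).toNat + (w f).toNat = 2)
    (hg : (x g).toNat + (y g).toNat + (w g).toNat = 2) :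
    (x f = true ∧ x g = true ∧ (y f = true ∨ w f = true)) ∨
      (y f = true ∧ y g = true ∧ (x f = true ∨ w f = true)) ∨
      (w f = true ∧ w g = true ∧ (x f = true ∨ y f = true)) := by
  cases hxf : x f <;> cases hyf : y f <;> cases hwf : w f <;> cases hxg : x g <;> cases hyg : y g <;>
    cases hwg : w g <;> simp_all

/-! ## Connections forced by the carried edges -/

omit [Fintype E] [DecidableEq E] [LinearOrder R] [IsStrictOrderedRing R] in
/-- A copy carrying all four edges of the cycle joins the roots. -/
lemma conn_roots_of_four {f₁ f₂ f₃ f₄ : E} (h1 : ends f₁ = s(a₁, b)) (h2 : ends f₂ = s(o, b))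
    (h3 : ends f₃ = s(o, a₃)) (h4 : ends f₄ = s(a₂, a₃)) (u : Config E) (hu1 : u f₁ = true)
    (hu2 : u f₂ = true) (hu3 : u f₃ = true) (hu4 : u f₄ = true) : Conn ends u a₂ a₁ := by
  have c1 : Conn ends u a₁ b := conn_of_openAdj ⟨f₁, hu1, h1⟩
  have c2 : Conn ends u o b := conn_of_openAdj ⟨f₂, hu2, h2⟩
  have c3 : Conn ends u o a₃ := conn_of_openAdj ⟨f₃, hu3, h3⟩
  have c4 : Conn ends u a₂ a₃ := conn_of_openAdj ⟨f₄, hu4, h4⟩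
  exact conn_trans c4 (conn_trans (conn_symm c3) (conn_trans c2 (conn_symm c1)))

omit [Fintype E] [DecidableEq E] [LinearOrder R] [IsStrictOrderedRing R] in
/-- A copy carrying `f₁, f₂` has `o ∈ C(a₁)`. -/
lemma conn_a1_o_of_f12 {f₁ f₂ : E} (h1 : ends f₁ = s(a₁, b)) (h2 : ends f₂ = s(o, b))
    (u : Config E) (hu1 : u f₁ = true) (hu2 : u f₂ = true) : Conn ends u a₁ o :=
  conn_trans (conn_of_openAdj ⟨f₁, hu1, h1⟩) (conn_symm (conn_of_openAdj ⟨f₂, hu2, h2⟩))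

omit [Fintype E] [DecidableEq E] [LinearOrder R] [IsStrictOrderedRing R] in
/-- A copy carrying `f₃, f₄` has `o ∈ C(a₂)`. -/
lemma conn_a2_o_of_f34 {f₃ f₄ : E} (h3 : ends f₃ = s(o, a₃)) (h4 : ends f₄ = s(a₂, a₃))
    (u : Config E) (hu3 : u f₃ = true) (hu4 : u f₄ = true) : Conn ends u a₂ o :=
  conn_trans (conn_of_openAdj ⟨f₄, hu4, h4⟩) (conn_symm (conn_of_openAdj ⟨f₃, hu3, h3⟩))

/-! ## The four terms -/

/-- The placement of `e` in the first copy. -/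
noncomputable abbrev T₁ (e : E) (x y w : Config E) : ℤ :=
  KBsym (st ends o a₁ a₂ a₃ b (Function.update x e true)) (st ends o a₁ a₂ a₃ b y)
    (st ends o a₁ a₂ a₃ b w)

/-- The placement of `e` in the second copy. -/
noncomputable abbrev T₂ (e : E) (x y w : Config E) : ℤ :=
  KBsym (st ends o a₁ a₂ a₃ b x) (st ends o a₁ a₂ a₃ b (Function.update y e true))
    (st ends o a₁ a₂ a₃ b w)

/-- The placement of `e` in the third copy. -/
noncomputable abbrev T₃ (e : E) (x y w : Config E) : ℤ :=
  KBsym (st ends o a₁ a₂ a₃ b x) (st ends o a₁ a₂ a₃ b y)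
    (st ends o a₁ a₂ a₃ b (Function.update w e true))

/-- The term without `e`. -/
noncomputable abbrev T₀ (x y w : Config E) : ℤ :=
  KBsym (st ends o a₁ a₂ a₃ b x) (st ends o a₁ a₂ a₃ b y) (st ends o a₁ a₂ a₃ b w)

omit [Fintype E] [LinearOrder R] [IsStrictOrderedRing R] in
/-- A copy with `o ∈ C(a₁)`: its placement is the term without `e`. -/
lemma T₁_eq_of_conn {e : E} (he : ends e = s(a₁, o)) (x y w : Config E) (hx : Conn ends x a₁ o) :
    T₁ ends o a₁ a₂ a₃ b e x y w = T₀ ends o a₁ a₂ a₃ b x y w := by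
  unfold T₁ T₀
  rw [TwoTyped.st_update_true_of_conn ends o a₁ a₂ a₃ b he x hx]

omit [Fintype E] [LinearOrder R] [IsStrictOrderedRing R] in
/-- The second copy with `o ∈ C(a₁)`: its placement is the term without `e`. -/
lemma T₂_eq_of_conn {e : E} (he : ends e = s(a₁, o)) (x y w : Config E) (hy : Conn ends y a₁ o) :
    T₂ ends o a₁ a₂ a₃ b e x y w = T₀ ends o a₁ a₂ a₃ b x y w := by
  unfold T₂ T₀
  rw [TwoTyped.st_update_true_of_conn ends o a₁ a₂ a₃ b he y hy]

omit [Fintype E] [LinearOrder R] [IsStrictOrderedRing R] in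
/-- The third copy with `o ∈ C(a₁)`: its placement is the term without `e`. -/
lemma T₃_eq_of_conn {e : E} (he : ends e = s(a₁, o)) (x y w : Config E) (hw : Conn ends w a₁ o) :
    T₃ ends o a₁ a₂ a₃ b e x y w = T₀ ends o a₁ a₂ a₃ b x y w := by
  unfold T₃ T₀
  rw [TwoTyped.st_update_true_of_conn ends o a₁ a₂ a₃ b he w hw]

omit [Fintype E] [LinearOrder R] [IsStrictOrderedRing R] in
/-- Opening `e = {a₁, o}` in a copy with `o ∈ C(a₂)` joins the roots. -/
lemma conn_roots_update {e : E} (he : ends e = s(a₁, o)) (u : Config E) (hu : Conn ends u a₂ o) :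
    Conn ends (Function.update u e true) a₂ a₁ :=
  conn_trans (conn_mono (le_update_true u e) hu)
    (conn_symm (conn_of_openAdj ⟨e, Function.update_self e true u, he⟩))

omit [Fintype E] [LinearOrder R] [IsStrictOrderedRing R] in
/-- A copy with `o ∈ C(a₂)`: its placement vanishes. -/
lemma T₁_eq_zero_of_conn {e : E} (he : ends e = s(a₁, o)) (x y w : Config E)
    (hx : Conn ends x a₂ o) : T₁ ends o a₁ a₂ a₃ b e x y w = 0 :=
  CoincRoot.KBsym_eq_zero_of_q' _ _ _
    (Or.inl (st_q'_of_conn ends o a₁ a₂ a₃ b _ (conn_roots_update ends o a₁ a₂ he x hx)))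

omit [Fintype E] [LinearOrder R] [IsStrictOrderedRing R] in
/-- The second copy with `o ∈ C(a₂)`: its placement vanishes. -/
lemma T₂_eq_zero_of_conn {e : E} (he : ends e = s(a₁, o)) (x y w : Config E)
    (hy : Conn ends y a₂ o) : T₂ ends o a₁ a₂ a₃ b e x y w = 0 :=
  CoincRoot.KBsym_eq_zero_of_q' _ _ _
    (Or.inr (Or.inl (st_q'_of_conn ends o a₁ a₂ a₃ b _ (conn_roots_update ends o a₁ a₂ he y hy))))

omit [Fintype E] [LinearOrder R] [IsStrictOrderedRing R] in
/-- The third copy with `o ∈ C(a₂)`: its placement vanishes. -/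
lemma T₃_eq_zero_of_conn {e : E} (he : ends e = s(a₁, o)) (x y w : Config E)
    (hw : Conn ends w a₂ o) : T₃ ends o a₁ a₂ a₃ b e x y w = 0 :=
  CoincRoot.KBsym_eq_zero_of_q' _ _ _
    (Or.inr (Or.inr (st_q'_of_conn ends o a₁ a₂ a₃ b _ (conn_roots_update ends o a₁ a₂ he w hw))))

omit [Fintype E] [LinearOrder R] [IsStrictOrderedRing R] in
/-- Every term vanishes when the first copy joins the roots. -/
lemma all_zero_of_x {e : E} (x y w : Config E) (hx : Conn ends x a₂ a₁) :
    T₁ ends o a₁ a₂ a₃ b e x y w + T₂ ends o a₁ a₂ a₃ b e x y w + T₃ ends o a₁ a₂ a₃ b e x y w =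
      T₀ ends o a₁ a₂ a₃ b x y w := by
  have hq := st_q'_of_conn ends o a₁ a₂ a₃ b x hx
  have hq' := st_q'_of_conn ends o a₁ a₂ a₃ b (Function.update x e true)
    (conn_mono (le_update_true x e) hx)
  unfold T₁ T₂ T₃ T₀
  rw [CoincRoot.KBsym_eq_zero_of_q' _ _ _ (Or.inl hq'), CoincRoot.KBsym_eq_zero_of_q' _ _ _ (Or.inl hq),
    CoincRoot.KBsym_eq_zero_of_q' _ _ _ (Or.inl hq), CoincRoot.KBsym_eq_zero_of_q' _ _ _ (Or.inl hq)]
  ring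

omit [Fintype E] [LinearOrder R] [IsStrictOrderedRing R] in
/-- Every term vanishes when the second copy joins the roots. -/
lemma all_zero_of_y {e : E} (x y w : Config E) (hy : Conn ends y a₂ a₁) :
    T₁ ends o a₁ a₂ a₃ b e x y w + T₂ ends o a₁ a₂ a₃ b e x y w + T₃ ends o a₁ a₂ a₃ b e x y w =
      T₀ ends o a₁ a₂ a₃ b x y w := by
  have hq := st_q'_of_conn ends o a₁ a₂ a₃ b y hy
  have hq' := st_q'_of_conn ends o a₁ a₂ a₃ b (Function.update y e true)
    (conn_mono (le_update_true y e) hy)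
  unfold T₁ T₂ T₃ T₀
  rw [CoincRoot.KBsym_eq_zero_of_q' _ _ _ (Or.inr (Or.inl hq)),
    CoincRoot.KBsym_eq_zero_of_q' _ _ _ (Or.inr (Or.inl hq')),
    CoincRoot.KBsym_eq_zero_of_q' _ _ _ (Or.inr (Or.inl hq)),
    CoincRoot.KBsym_eq_zero_of_q' _ _ _ (Or.inr (Or.inl hq))]
  ring

end Main

end Triangle

end CovForm

end Summit.Ventures.PercRepro2
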